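import Literature.NumberTheory.Transcendental.TorusConeBasics
import Literature.RingTheory.KrullDimension.AffineDimension
import Mathlib.RingTheory.Nullstellensatz
import Mathlib.RingTheory.Ideal.MinimalPrime.Noetherian
import Mathlib.Analysis.Complex.Polynomial.Basic
import HarnessLib

/-!
# A lower bound for the dimension of a subtorus through transversal coordinates

Topic: `Literature/NumberTheory/Transcendental` (support for `Philippon1986_zeroEstimate_torus_holds`).
Let `H_A ≤ T = (ℂˣ)ⁿ` be the subtorus of a subgroup `A ≤ ℤⁿ` (`Torus.subtorus`) and `W` a set
of coordinates such that no non-zero member of `A` is supported on `W`. Then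

* `eq_zero_of_vars_subset_of_mem_vanishingIdeal` — a polynomial in the variables `X_w`, `w ∈ W`,
  vanishing on `H_A` is zero: its monomials restrict to pairwise distinct characters of `H_A`
  (duality `ann(H_A) = A`, `Torus.mem_of_forall_subtorus_char_eq_one`), which are linearly
  independent (Dedekind); i.e. the coordinates `X_w` are algebraically independent on `H_A`;
* **`card_le_ringKrullDim_quotient_vanishingIdeal`** — consequently
  `dim ℂ[X] ⧸ I(H_A) ≥ |W|` (some minimal prime `𝔮` of the radical ideal `I(H_A)` still meets
  `ℂ[X_W]` trivially, and `dim = trdeg` for the affine domain `ℂ[X]/𝔮`,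
  `Literature.RingTheory.KrullDimension.exists_ringKrullDim_eq_and_trdeg_eq`).

With `exists_transversal_coordinates` this gives `dim I(H_A) ≥ n - rank A`, the inequality
`codim H_A ≤ rank A` of Nesterenko–Philippon (eds.), LNM 1752, Ch. 11 §2.1 Example
("`codim H_A = rank A`"; only the inequality is needed and proved).

## References

* Yu. V. Nesterenko, P. Philippon (eds.), *Introduction to Algebraic Independence Theory*,
  LNM 1752 (2001), Ch. 11 (D. Roy), §2.1, Example (p. 199). [NesterenkoPhilippon2001]
-/

noncomputable section

open MvPolynomial

namespace Literature.NumberTheory.Transcendental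

open Torus

variable {n : ℕ}

/-- **Coordinates transversal to `A` are algebraically independent on `H_A`**: if no non-zero
member of `A` is supported on `W`, a polynomial in the `X_w`, `w ∈ W`, vanishing on `H_A` is zero.
[cite: NesterenkoPhilippon2001, Ch. 11 §2.1 Example p. 199] -/
theorem eq_zero_of_vars_subset_of_mem_vanishingIdeal (A : AddSubgroup (Fin n → ℤ))
    {W : Finset (Fin n)} (hW : ∀ a ∈ A, (∀ i, i ∉ W → a i = 0) → a = 0)
    {f : MvPolynomial (Fin n) ℂ} (hvars : ∀ m ∈ f.support, ∀ i, i ∉ W → m i = 0)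
    (hf : f ∈ vanishingIdeal ℂ ((fun (g : Torus n) (i : Fin n) => ((g i : ℂˣ) : ℂ)) '' (subtorus A : Set (Torus n)))) : f = 0 := by
  classical
  by_contra hf0
  -- the characters `z ↦ z^m` of `H_A`, `m ∈ supp f`, with values in `ℂ`
  let ψ : (Fin n →₀ ℕ) → (↥(subtorus A) →* ℂ) := fun m =>
    { toFun := fun z => ∏ i, ((z.1 i : ℂˣ) : ℂ) ^ (m i)
      map_one' := by simp
      map_mul' := fun z w => by
        simp only [Subgroup.coe_mul, Pi.mul_apply, Units.val_mul, mul_pow,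
          Finset.prod_mul_distrib] }
  have hψ : ∀ (m : Fin n →₀ ℕ) (z : ↥(subtorus A)), ψ m z = ∏ i, ((z.1 i : ℂˣ) : ℂ) ^ (m i) :=
    fun _ _ => rfl
  -- distinct monomials of `f` give distinct characters
  have hinj : Function.Injective (fun m : ↥f.support => ψ (m : Fin n →₀ ℕ)) := by
    intro m m' heq
    apply Subtype.ext
    -- `χ_{m - m'}` is trivial on `H_A`, so `m - m' ∈ A`, supported on `W`, hence `0`
    have hmem : (fun i => (m.1 i : ℤ) - (m'.1 i : ℤ)) ∈ A := by
      apply mem_of_forall_subtorus_char_eq_one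
      intro z hz
      have h1 : (∏ i, ((z i : ℂˣ) : ℂ) ^ (m.1 i)) = ∏ i, ((z i : ℂˣ) : ℂ) ^ (m'.1 i) := by
        have := DFunLike.congr_fun heq ⟨z, hz⟩
        simpa only [hψ] using this
      have h2 : (∏ i, (z i) ^ (m.1 i) : ℂˣ) = ∏ i, (z i) ^ (m'.1 i) := by
        apply Units.val_injective
        simpa [Units.val_pow_eq_pow_val] using h1
      simp only [char_apply, zpow_sub, zpow_natCast]
      rw [Finset.prod_mul_distrib, Finset.prod_inv_distrib, h2, mul_inv_cancel]
    have hzero := hW _ hmem fun i hi => by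
      simp only [hvars m.1 m.2 i hi, hvars m'.1 m'.2 i hi, sub_self]
    ext i
    have := congr_fun hzero i
    simp only [Pi.zero_apply, sub_eq_zero, Nat.cast_inj] at this
    exact this
  have hLI := (linearIndependent_monoidHom ↥(subtorus A) ℂ).comp _ hinj
  rw [Fintype.linearIndependent_iff] at hLI
  have hsum : ∑ m : ↥f.support, f.coeff m •
      ((fun g : ↥(subtorus A) →* ℂ => (g : ↥(subtorus A) → ℂ)) ∘
        fun m : ↥f.support => ψ (m : Fin n →₀ ℕ)) m = 0 := by
    funext z
    simp only [Finset.sum_apply, Pi.smul_apply, Function.comp_apply, smul_eq_mul,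
      Pi.zero_apply, hψ]
    have := (mem_vanishingIdeal_iff.mp hf) ((fun (g : Torus n) (i : Fin n) => ((g i : ℂˣ) : ℂ)) z.1) ⟨z.1, z.2, rfl⟩
    change MvPolynomial.eval ((fun (g : Torus n) (i : Fin n) => ((g i : ℂˣ) : ℂ)) z.1) f = 0 at this
    rw [MvPolynomial.eval_eq'] at this
    rw [← this]
    exact Finset.sum_coe_sort f.support (fun m => f.coeff m * ∏ i, ((z.1 i : ℂˣ) : ℂ) ^ (m i))
  obtain ⟨m, hm⟩ := MvPolynomial.support_nonempty.mpr hf0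
  exact (MvPolynomial.mem_support_iff.mp hm) (hLI (fun m => f.coeff m) hsum ⟨m, hm⟩)


/-- A vanishing ideal is radical. [folklore] -/
theorem isRadical_vanishingIdeal {K : Type*} [Field K] (V : Set (Fin n → K)) :
    (vanishingIdeal K V).IsRadical := by
  intro f ⟨k, hk⟩
  rw [mem_vanishingIdeal_iff] at hk ⊢
  intro x hx
  have := hk x hx
  rw [map_pow] at this
  exact (pow_eq_zero_iff'.mp this).1

/-- **`dim ℂ[X] ⧸ I(H_A) ≥ |W|` for coordinates `W` transversal to `A`**: some minimal prime `𝔮`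
of the radical ideal `I(H_A)` contains no non-zero polynomial in the `X_w` (`w ∈ W`) — otherwise
the product of such polynomials, one for each minimal prime, would be a non-zero polynomial in
the `X_w` lying in `I(H_A)` — so the `X_w` are algebraically independent in the affine domain
`ℂ[X]/𝔮`, whose dimension is its transcendence degree. [cite: NesterenkoPhilippon2001, Ch. 11 §2.1 Example p. 199] -/
theorem card_le_ringKrullDim_quotient_vanishingIdeal (A : AddSubgroup (Fin n → ℤ))
    {W : Finset (Fin n)} (hW : ∀ a ∈ A, (∀ i, i ∉ W → a i = 0) → a = 0) :
    (W.card : WithBot ℕ∞) ≤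
      ringKrullDim (MvPolynomial (Fin n) ℂ ⧸ vanishingIdeal ℂ ((fun (g : Torus n) (i : Fin n) => ((g i : ℂˣ) : ℂ)) '' (subtorus A : Set (Torus n)))) := by
  classical
  set I := vanishingIdeal ℂ ((fun (g : Torus n) (i : Fin n) => ((g i : ℂˣ) : ℂ)) '' (subtorus A : Set (Torus n))) with hI
  -- polynomials in the variables `W`: `rename Subtype.val g`
  let φ : MvPolynomial ↥W ℂ →ₐ[ℂ] MvPolynomial (Fin n) ℂ := rename ((↑) : ↥W → Fin n)
  have hφvars : ∀ g : MvPolynomial ↥W ℂ, ∀ m ∈ (φ g).support, ∀ i, i ∉ W → m i = 0 := by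
    intro g m hm i hi
    by_contra hne
    have hiv : i ∈ (φ g).vars := (mem_vars_iff_mem_support i).mpr ⟨m, hm, Finsupp.mem_support_iff.mpr hne⟩
    have := vars_rename ((↑) : ↥W → Fin n) g hiv
    rw [Finset.mem_image] at this
    obtain ⟨w, -, rfl⟩ := this
    exact hi w.2
  have hφinj : Function.Injective φ := rename_injective _ Subtype.val_injective
  -- some minimal prime of `I` meets `ℂ[X_W]` trivially
  have hfin := Ideal.finite_minimalPrimes_of_isNoetherianRing _ I
  have hex : ∃ 𝔮 ∈ I.minimalPrimes, ∀ g : MvPolynomial ↥W ℂ, φ g ∈ 𝔮 → g = 0 := by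
    by_contra hcon
    push Not at hcon
    choose! g hg𝔮 hg0 using hcon
    set G : MvPolynomial ↥W ℂ := ∏ 𝔮 ∈ hfin.toFinset, g 𝔮 with hG
    have hG0 : G ≠ 0 := Finset.prod_ne_zero_iff.mpr fun 𝔮 h𝔮 => hg0 𝔮 ((hfin.mem_toFinset).mp h𝔮)
    have hGI : φ G ∈ I := by
      rw [hI, ← (isRadical_vanishingIdeal _).radical, ← Ideal.sInf_minimalPrimes, Ideal.mem_sInf]
      intro 𝔮 h𝔮
      rw [hG, map_prod, ← Finset.mul_prod_erase _ _ ((hfin.mem_toFinset).mpr h𝔮)]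
      exact Ideal.mul_mem_right _ _ (hg𝔮 𝔮 h𝔮)
    exact hG0 (hφinj (by
      rw [map_zero]
      exact eq_zero_of_vars_subset_of_mem_vanishingIdeal A hW (hφvars G) hGI))
  obtain ⟨𝔮, h𝔮, h𝔮W⟩ := hex
  haveI : 𝔮.IsPrime := h𝔮.1.1
  -- `X_w`, `w ∈ W`, are algebraically independent in the affine domain `ℂ[X]/𝔮`
  set B := MvPolynomial (Fin n) ℂ ⧸ 𝔮 with hB
  haveI : Algebra.FiniteType ℂ B :=
    Algebra.FiniteType.of_surjective (Ideal.Quotient.mkₐ ℂ 𝔮) (Ideal.Quotient.mkₐ_surjective ℂ 𝔮)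
  have hind : AlgebraicIndependent ℂ (fun w : ↥W => Ideal.Quotient.mk 𝔮 (X (w : Fin n))) := by
    have hcomp : MvPolynomial.aeval (fun w : ↥W => Ideal.Quotient.mk 𝔮 (X (w : Fin n))) =
        (Ideal.Quotient.mkₐ ℂ 𝔮).comp φ := by
      apply MvPolynomial.algHom_ext
      intro w
      simp [φ]
    intro g₁ g₂ hg
    rw [hcomp] at hg
    have h0 : (Ideal.Quotient.mkₐ ℂ 𝔮) (φ (g₁ - g₂)) = 0 := by
      rw [map_sub, map_sub, sub_eq_zero]; exact hg
    rw [Ideal.Quotient.mkₐ_eq_mk, Ideal.Quotient.eq_zero_iff_mem] at h0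
    exact sub_eq_zero.mp (h𝔮W _ h0)
  obtain ⟨s, hs, ht⟩ := Literature.RingTheory.KrullDimension.exists_ringKrullDim_eq_and_trdeg_eq ℂ B
  have hcard := hind.cardinalMk_le_trdeg
  rw [ht, Cardinal.mk_fintype, Fintype.card_coe] at hcard
  have hWs : W.card ≤ s := by exact_mod_cast hcard
  calc (W.card : WithBot ℕ∞) ≤ (s : WithBot ℕ∞) := by exact_mod_cast hWs
    _ = ringKrullDim B := hs.symm
    _ ≤ ringKrullDim (MvPolynomial (Fin n) ℂ ⧸ I) :=
        ringKrullDim_le_of_surjective (Ideal.Quotient.factor h𝔮.1.2) (Ideal.Quotient.factor_surjective _)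

end Literature.NumberTheory.Transcendental

end
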